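import Mathlib.MeasureTheory.Integral.IntervalIntegral.Basic
import Mathlib.MeasureTheory.Function.StronglyMeasurable.AEStronglyMeasurable
import Mathlib.MeasureTheory.Measure.Prod
import Mathlib.Probability.Moments.Basic
import Mathlib.Probability.Moments.Variance
import Literature.Analysis.FunctionSpaces.FlatTorus
import Literature.Analysis.FunctionSpaces.TorusCalculus
import Literature.Analysis.FunctionSpaces.TorusTestFunction
import Literature.Analysis.FunctionSpaces.TorusSobolevNorm
import HarnessLib

-- provenance: harness21/H21/H21/Prelude/FluidKinetic/PassiveScalar.lean @ d20076f (interim HEAD d8f2665); M5 mechanical rewrite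
/-!
# Passive scalar transport on the flat torus (trunk: FluidKinetic, F14 / notion
`passive_scalar_transport`)

The advection–diffusion (passive scalar) equation on `T^d × [0, T)`,

  `∂ₜθ + u·∇θ = κ Δθ`, `div u = 0`, `θ(0) = θ₀`,

for a *given* divergence-free velocity field `u : ℝ → T^d → ℝ^d` (time first, as everywhere in
H21) and diffusivity `κ ≥ 0`, following the outline `H21/Outlines/FluidKinetic.md`, §F14:

* `Torus.IsClassicalScalarTransportOn S κ u θ`: smooth solutions on a time set `S`, one-sided
  time derivative `Torus.timeDerivWithin S` (the convention of the accepted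
  `Torus.IsClassicalNSSolutionOn` / `NS.IsNavierStokesSolution`);
* `Torus.IsWeakScalarTransportOn T κ u θ₀ θ`: distributional solutions on `T^d × [0,T)` with datum
  `θ₀`, in the class `θ ∈ L^∞_t L²_x`, `u ∈ L¹_t L²_x`, `u θ ∈ L¹_{t,x}` (DiPerna–Lions 1989,
  (12)–(14) with `p = 2`; test functions `Torus.IsSpaceTimeTest T ψ` may be nonzero at `t = 0`,
  encoding the datum);
* the functionals `Torus.scalarGradNormSq θ = ‖∇θ‖²_{L²}`, its spectral `ℝ≥0∞` version
  `Torus.eScalarGradNormSq`, the cumulative scalar dissipations `Torus.scalarDissipation`,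
  `Torus.eScalarDissipation` (`κ ∫ₐᵇ ‖∇θ(t)‖² dt`), `Torus.scalarMean`, `Torus.scalarVariance`,
  `Torus.scalarL2Sq`;
* API (proofs `sorry`): the classical variance balance `d/dt ‖θ‖² = -2κ ‖∇θ‖²`, classical ⇒ weak,
  DiPerna–Lions uniqueness for `u ∈ L¹_t W^{1,∞}_x`, existence of energy solutions for `κ > 0`,
  `θ₀ ∈ L²`, `u ∈ L^∞`, and the energy inequalities `2κ ∫₀ᵀ ‖∇θ‖² ≤ ‖θ₀‖²_{L²}`,
  `2κ ∫₀ᵀ ‖∇θ‖² ≤ Var θ₀` (`eScalarDissipation_le_variance`).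

## Mathlib

* Mathlib has no transport / advection–diffusion equation and no calculus on `UnitAddTorus`; all
  differential operators are the G03 wrappers of `Literature.Prelude.Sobolev.TorusCalculus`
  (`Torus.gradient`, `Torus.laplacian`, `Torus.timeDerivWithin`, …).
* The variance of a scalar on the probability space `T^d` **is** Mathlib's
  `ProbabilityTheory.variance θ volume` (`Mathlib/Probability/Moments/Variance.lean`);
  `Torus.scalarVariance` is a named abbreviation for it and `scalarVariance_eq_integral` is
  Mathlib's `variance_eq_integral`. The mean `∫ θ` equals Mathlib's average `⨍ θ`
  (`MeasureTheory.average_eq_integral`, probability measure), and `‖θ‖²_{L²} = ∫ θ²` is Mathlib's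
  second moment `ProbabilityTheory.moment θ 2 volume` (`scalarL2Sq_eq_moment`, `rfl`).
* `u(t) ∈ W^{1,∞}(T^d)` is expressed as `LipschitzWith (L t) (u t)` for the sup-of-quotient metric
  of `UnitAddTorus d = d → AddCircle 1` (Mathlib's `AddCircle` normed group, `Pi` sup norm), which
  is bi-Lipschitz to the flat metric.

## References

* R. J. DiPerna, P.-L. Lions, *Ordinary differential equations, transport theory and Sobolev
  spaces*, Invent. Math. 98 (1989), 511–547: §II.1 (weak solutions, (12)–(14)), Prop. II.1
  (existence), Thm. II.2, Cor. II.1, Thm. II.3 (uniqueness, renormalisation).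
* T. D. Drivas, T. M. Elgindi, G. Iyer, I.-J. Jeong, *Anomalous dissipation in passive scalar
  transport*, Arch. Ration. Mech. Anal. 243 (2022), (1.1)–(1.3).
* S. Armstrong, V. Vicol, *Anomalous diffusion by fractal homogenization*, Ann. PDE 11 (2025),
  §1.1.
* C. Le Bris, P.-L. Lions, *Existence and uniqueness of solutions to Fokker–Planck type equations
  with irregular coefficients*, Comm. PDE 33 (2008), 1272–1317; A. Figalli, *Existence and
  uniqueness of martingale solutions for SDEs with rough or degenerate coefficients*, JFA 254
  (2008), 109–153 (uniqueness with viscosity `κ > 0`).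
* L. C. Evans, *Partial Differential Equations* (2nd ed., 2010), §7.1.2 (weak solutions of
  parabolic equations, energy estimates).
-/

open MeasureTheory Set Topology ProbabilityTheory
open scoped InnerProductSpace ENNReal NNReal

namespace Literature.Analysis.FluidPDE

noncomputable section

namespace Torus

variable {d : Type*} [Fintype d] [DecidableEq d]

/-! ## Scalar functionals -/

section Functionals

omit [DecidableEq d]

/-- The squared `L²` norm of the scalar gradient, `‖∇θ‖²_{L²} = ∫_{T^d} ‖∇θ(x)‖² dx`
(DEIJ 2022, (1.2): the quantity whose time integral is the scalar dissipation). Meaningful for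
`C¹` scalars; for rough `θ` use the spectral `Torus.eScalarGradNormSq`. Junk: `0`-valued Bochner
integral if `‖∇θ‖²` is not integrable. [cite: DEIJ2022, (1.2] -/
def scalarGradNormSq (θ : UnitAddTorus d → ℝ) : ℝ :=
  ∫ x, ‖FunctionSpaces.Torus.gradient θ x‖ ^ 2

/-- The spectral squared gradient norm `‖∇θ‖²_{L²} = 4π² ∑_{k ≠ 0} |k|² |θ̂(k)|² ∈ [0, ∞]` of a
(possibly non-smooth) real scalar, via the homogeneous `Ḣ¹` seminorm of `θ` viewed in `ℂ`
(`Torus.eHomSobolevSeminorm`, characters `e^{2πi k·x}`, whence `4π²`; DEIJ 2022, (1.2)). Agrees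
with `scalarGradNormSq` on smooth scalars (`scalarGradNormSq_eq_toReal`).
**Junk note (C4):** `mFourierCoeff f k` is a Bochner integral, hence `0` for non-integrable `f`,
so `eScalarGradNormSq θ = 0` for non-integrable `θ`; meaningful only for integrable `θ`. [cite: DEIJ2022, (1.2] -/
def eScalarGradNormSq (θ : UnitAddTorus d → ℝ) : ℝ≥0∞ :=
  ENNReal.ofReal (4 * Real.pi ^ 2) * FunctionSpaces.Torus.eHomSobolevSeminorm 1 (fun x => (θ x : ℂ)) ^ 2

/-- The cumulative scalar dissipation `κ ∫ₐᵇ ‖∇θ(t)‖²_{L²} dt` over the time interval `[a, b]`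
(interval integral; DEIJ 2022, (1.2)–(1.3); Armstrong–Vicol 2025, §1.1). Junk value `0` if
`t ↦ scalarGradNormSq (θ t)` is not interval integrable. [cite: DEIJ2022, (1.2] -/
def scalarDissipation (κ : ℝ) (θ : ℝ → UnitAddTorus d → ℝ) (a b : ℝ) : ℝ :=
  κ * ∫ t in a..b, scalarGradNormSq (θ t)

/-- The cumulative scalar dissipation `κ ∫_{(a,b)} ‖∇θ(t)‖²_{L²} dt ∈ [0, ∞]` of a rough scalar,
via the spectral `eScalarGradNormSq` (DEIJ 2022, (1.2)–(1.3)). Junk: `ENNReal.ofReal κ = 0` for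
`κ ≤ 0`, and the C4 junk of `eScalarGradNormSq` at times where `θ t` is not integrable. [cite: DEIJ2022, (1.2] -/
def eScalarDissipation (κ : ℝ) (θ : ℝ → UnitAddTorus d → ℝ) (a b : ℝ) : ℝ≥0∞ :=
  ENNReal.ofReal κ * ∫⁻ t in Ioo a b, eScalarGradNormSq (θ t)

/-- The spatial mean `∫_{T^d} θ` of a scalar; since `volume` on `T^d` is a probability measure
this is Mathlib's average `⨍ x, θ x` (`scalarMean_eq_average`) (DEIJ 2022, §1: mean-zero data).
Junk: `0` for non-integrable `θ`. [cite: DEIJ2022, §1: mean-zero data] -/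
def scalarMean (θ : UnitAddTorus d → ℝ) : ℝ :=
  ∫ x, θ x

/-- The variance `∫_{T^d} (θ - ∫ θ)²` of a scalar on the probability space `T^d`: this **is**
Mathlib's `ProbabilityTheory.variance θ volume` (defined there through a lower Lebesgue integral,
so the junk value for `θ ∉ L²` is `0`); the integral formula is `scalarVariance_eq_integral`
(DEIJ 2022, (1.1)–(1.3): `‖θ(t)‖²_{L²}` for mean-zero `θ`). [cite: DEIJ2022, (1.1] -/
def scalarVariance (θ : UnitAddTorus d → ℝ) : ℝ :=
  variance θ volume

/-- The squared `L²` norm `‖θ‖²_{L²} = ∫_{T^d} θ²` of a scalar (DEIJ 2022, (1.3); Armstrong–Vicol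
2025, §1.1); definitionally Mathlib's second moment `ProbabilityTheory.moment θ 2 volume`
(`scalarL2Sq_eq_moment`). Junk: `0` for `θ ∉ L²`. [cite: DEIJ2022, (1.3] -/
def scalarL2Sq (θ : UnitAddTorus d → ℝ) : ℝ :=
  ∫ x, θ x ^ 2

/-- `‖θ‖²_{L²}` is Mathlib's second moment `μ[θ ^ 2]` on the probability space `T^d`
(`ProbabilityTheory.moment`, `Mathlib/Probability/Moments/Basic.lean`). [folklore] -/
theorem scalarL2Sq_eq_moment (θ : UnitAddTorus d → ℝ) : scalarL2Sq θ = moment θ 2 volume := rfl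

/-- `‖∇θ‖²_{L²} ≥ 0`. [folklore] -/
theorem scalarGradNormSq_nonneg (θ : UnitAddTorus d → ℝ) : 0 ≤ scalarGradNormSq θ :=
  integral_nonneg fun _ => sq_nonneg _

/-- `‖θ‖²_{L²} ≥ 0`. [folklore] -/
theorem scalarL2Sq_nonneg (θ : UnitAddTorus d → ℝ) : 0 ≤ scalarL2Sq θ :=
  integral_nonneg fun _ => sq_nonneg _

/-- The variance is nonnegative (Mathlib `ProbabilityTheory.variance_nonneg`). [folklore] -/
theorem scalarVariance_nonneg (θ : UnitAddTorus d → ℝ) : 0 ≤ scalarVariance θ :=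
  variance_nonneg _ _

/-- The scalar dissipation is nonnegative for `κ ≥ 0` and `a ≤ b`. [folklore] -/
theorem scalarDissipation_nonneg {κ : ℝ} (hκ : 0 ≤ κ) (θ : ℝ → UnitAddTorus d → ℝ) {a b : ℝ}
    (hab : a ≤ b) : 0 ≤ scalarDissipation κ θ a b :=
  mul_nonneg hκ (intervalIntegral.integral_nonneg hab fun _ _ => scalarGradNormSq_nonneg _)

/-- The mean is Mathlib's average: `∫ θ = ⨍ θ` on the probability space `T^d`
(`MeasureTheory.average_eq_integral`). [folklore] -/
theorem scalarMean_eq_average (θ : UnitAddTorus d → ℝ) : scalarMean θ = ⨍ x, θ x :=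
  (average_eq_integral volume θ).symm

/-- The variance as an integral, `Var θ = ∫ (θ - ∫ θ)²`, for a.e.-measurable `θ`
(Mathlib `ProbabilityTheory.variance_eq_integral`). [folklore] -/
theorem scalarVariance_eq_integral {θ : UnitAddTorus d → ℝ} (hθ : AEMeasurable θ volume) :
    scalarVariance θ = ∫ x, (θ x - scalarMean θ) ^ 2 :=
  variance_eq_integral hθ

/-- `‖θ‖²_{L²} = Var θ + (∫ θ)²` for `θ ∈ L²(T^d)` (Mathlib `ProbabilityTheory.variance_def'`). [folklore] -/
theorem scalarL2Sq_eq_scalarVariance_add_sq {θ : UnitAddTorus d → ℝ} (hθ : MemLp θ 2 volume) :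
    scalarL2Sq θ = scalarVariance θ + scalarMean θ ^ 2 := by
  rw [scalarVariance, variance_eq_sub hθ, scalarL2Sq, scalarMean, sub_add_cancel]
  rfl

/-- For smooth `θ`, the derivative-based and spectral squared gradient norms agree:
`∫ ‖∇θ‖² = 4π² ∑ₖ |k|² |θ̂(k)|²` (Parseval and `𝓕(∂ᵢθ)(k) = 2πi kᵢ θ̂(k)`; Grafakos, Prop. 3.2.6
(8), §3.3; cf. `Torus.eSobolevNorm_one_sq_eq`). DISCHARGED in the tree by
`scalarGradNormSq_eq_toReal_holds` (`FluidPDE/PassiveScalarEnergySlice.lean`).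
[cite: Grafakos2014, Prop. 3.2.6 (8) with Prop. 3.2.7 (3)] -/
def scalarGradNormSq_eq_toReal : Prop :=
  ∀ {θ : UnitAddTorus d → ℝ} (hθ : FunctionSpaces.Torus.IsSmooth θ),
    scalarGradNormSq θ = (eScalarGradNormSq θ).toReal

end Functionals

/-! ## Classical solutions -/

section Classical

/-- Classical (smooth) solutions of the passive scalar equation with diffusivity `κ` driven by
the velocity field `u` on `T^d × S`, `S ⊆ ℝ` a time set (typically `Icc 0 T` or `Ici 0`):
`∂ₜθ + u·∇θ = κ Δθ`, `div u = 0`, with `u` and `θ` jointly `C^∞` on `S × T^d`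
(DEIJ 2022, (1.1); Armstrong–Vicol 2025, §1.1, (1.1)). The time derivative is the **one-sided**
`Torus.timeDerivWithin S`, the convention of the accepted `Torus.IsClassicalNSSolutionOn` /
`NS.IsNavierStokesSolution`. Initial data are a separate hypothesis `θ 0 = θ₀` in statements;
pure transport is the case `κ = 0`. [cite: DEIJ2022, (1.1] -/
structure IsClassicalScalarTransportOn (S : Set ℝ) (κ : ℝ)
    (u : ℝ → UnitAddTorus d → EuclideanSpace ℝ d) (θ : ℝ → UnitAddTorus d → ℝ) : Prop where
  /-- The velocity is jointly smooth on `S × T^d`. -/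
  smooth_velocity : FunctionSpaces.Torus.IsSmoothSpaceTimeOn S u
  /-- The scalar is jointly smooth on `S × T^d`. -/
  smooth_scalar : FunctionSpaces.Torus.IsSmoothSpaceTimeOn S θ
  /-- The advection–diffusion equation `∂ₜθ + u·∇θ = κ Δθ` holds pointwise on `S × T^d`. -/
  transport : ∀ t ∈ S, ∀ x,
    FunctionSpaces.Torus.timeDerivWithin S θ t x + ⟪u t x, FunctionSpaces.Torus.gradient (θ t) x⟫_ℝ = κ * FunctionSpaces.Torus.laplacian (θ t) x
  /-- Incompressibility `div u(t) = 0` for `t ∈ S`. -/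
  divFree : ∀ t ∈ S, FunctionSpaces.Torus.IsDivFree (u t)

namespace IsClassicalScalarTransportOn

variable {S : Set ℝ} {κ : ℝ} {u : ℝ → UnitAddTorus d → EuclideanSpace ℝ d}
  {θ : ℝ → UnitAddTorus d → ℝ}

/-- Conservation of the mean for classical solutions: on a convex time set `S`,
`d/dt ∫ θ(t) = 0` (integrate the equation over `T^d`: `∫ u·∇θ = -∫ θ div u = 0` and `∫ Δθ = 0`
by `Torus.integral_inner_gradient_eq_neg_integral_mul_divergence`,
`Torus.integral_mul_laplacian_comm`; DEIJ 2022, §1). Convexity of `S` justifies differentiating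
under the integral over the compact `T^d` within `S`. [cite: DEIJ2022, §1] -/
def hasDerivWithinAt_scalarMean : Prop :=
  ∀ (h : IsClassicalScalarTransportOn S κ u θ) (hS : Convex ℝ S) {t : ℝ} (ht : t ∈ S),
    HasDerivWithinAt (fun s => scalarMean (θ s)) 0 S t

/-- The `L²` balance for classical solutions: on a convex time set `S`,
`d/dt ‖θ(t)‖²_{L²} = -2κ ‖∇θ(t)‖²_{L²}`, i.e. `d/dt ½‖θ‖² = -κ‖∇θ‖²` (multiply the equation by
`θ`, integrate over `T^d`; the transport term `∫ θ u·∇θ = ½ ∫ u·∇(θ²)` vanishes by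
incompressibility and `∫ θ Δθ = -∫ ‖∇θ‖²`; DEIJ 2022, (1.2); Armstrong–Vicol 2025, (1.3)). [cite: DEIJ2022, (1.2] -/
def hasDerivWithinAt_scalarL2Sq : Prop :=
  ∀ (h : IsClassicalScalarTransportOn S κ u θ) (hS : Convex ℝ S) {t : ℝ} (ht : t ∈ S),
    HasDerivWithinAt (fun s => scalarL2Sq (θ s)) (-(2 * κ) * scalarGradNormSq (θ t)) S t

/-- The variance balance for classical solutions: `d/dt Var θ(t) = -2κ ‖∇θ(t)‖²_{L²}` on a convex
time set (`Var θ = ‖θ‖² - (∫ θ)²`, `scalarL2Sq_eq_scalarVariance_add_sq`, and the mean is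
conserved, `hasDerivWithinAt_scalarMean`; DEIJ 2022, (1.2)). [cite: DEIJ2022, (1.2] -/
def hasDerivWithinAt_scalarVariance : Prop :=
  ∀ (h : IsClassicalScalarTransportOn S κ u θ) (hS : Convex ℝ S) {t : ℝ} (ht : t ∈ S),
    HasDerivWithinAt (fun s => scalarVariance (θ s)) (-(2 * κ) * scalarGradNormSq (θ t)) S t

/-- Integrated form of the `L²` balance: for classical solutions on `S ⊇ [a, b]`,
`‖θ(b)‖² + 2 κ ∫ₐᵇ ‖∇θ‖² = ‖θ(a)‖²`, i.e. `scalarL2Sq (θ b) + 2 * scalarDissipation κ θ a b =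
scalarL2Sq (θ a)` (fundamental theorem of calculus applied to `hasDerivWithinAt_scalarL2Sq`;
DEIJ 2022, (1.2)–(1.3)). [cite: DEIJ2022, (1.2] -/
def scalarL2Sq_add_scalarDissipation : Prop :=
  ∀ (h : IsClassicalScalarTransportOn S κ u θ) {a b : ℝ} (hab : a ≤ b) (hS : Icc a b ⊆ S),
    scalarL2Sq (θ b) + 2 * scalarDissipation κ θ a b = scalarL2Sq (θ a)

/-- Restriction of the time set to `S ∩ Ioi a` (drop an initial segment): the one-sided time
derivatives within `S` and within `S ∩ Ioi a` agree at every `t > a` (`derivWithin_inter`). [folklore] -/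
theorem mono_inter_Ioi (h : IsClassicalScalarTransportOn S κ u θ) (a : ℝ) :
    IsClassicalScalarTransportOn (S ∩ Ioi a) κ u θ where
  smooth_velocity := h.smooth_velocity.mono (prod_mono inter_subset_left le_rfl)
  smooth_scalar := h.smooth_scalar.mono (prod_mono inter_subset_left le_rfl)
  transport t ht x := by
    have : FunctionSpaces.Torus.timeDerivWithin (S ∩ Ioi a) θ t x = FunctionSpaces.Torus.timeDerivWithin S θ t x :=
      derivWithin_inter (Ioi_mem_nhds ht.2)
    rw [this]
    exact h.transport t ht.1 x
  divFree t ht := h.divFree t ht.1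

end IsClassicalScalarTransportOn

end Classical

/-! ## Weak (distributional) solutions on `T^d × [0, T)` -/

section Weak

omit [DecidableEq d] in
/-- Weak (distributional) solutions of the passive scalar equation `∂ₜθ + u·∇θ = κΔθ` on
`T^d × [0,T)` with initial datum `θ₀` and a given velocity field `u` (DiPerna–Lions 1989, §II.1,
(12)–(14) with `p = 2`, `q = 2`, plus viscosity; DEIJ 2022, (1.1); Evans, §7.1.2): `θ` and `u`
are (a.e. strongly) measurable on `(0,T) × T^d`; `θ ∈ L^∞(0,T; L²(T^d))`; `u ∈ L¹(0,T; L²(T^d))`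
(DiPerna–Lions' standing local integrability of the drift, which makes `u(t)` integrable for
a.e. `t`, so that weak incompressibility below is a statement about genuine integrals);
`u θ ∈ L¹((0,T) × T^d)` (so that the transport term makes sense); `u(t)` is weakly divergence
free for a.e. `t`; and for
every smooth real space–time test function `ψ` vanishing near `t = T` (`Torus.IsSpaceTimeTest T`,
possibly nonzero at `t = 0`),
`∫₀ᵀ ∫ θ (∂ₜψ + u·∇ψ + κ Δψ) dx dt + ∫ θ₀ ψ(0) dx = 0`.
Test functions live on all of `ℝ` in time, so `∂ₜψ` is the two-sided `Torus.timeDeriv`. No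
regularity `θ ∈ L²_t H¹_x` is built in (it is a *consequence* for `κ > 0`, `u ∈ L^∞`, see
`IsWeakScalarTransportOn.energy_ineq`), so that the notion also covers pure transport `κ = 0`. [cite: DiPernaLions1989, §II.1  (12] -/
structure IsWeakScalarTransportOn (T κ : ℝ) (u : ℝ → UnitAddTorus d → EuclideanSpace ℝ d)
    (θ₀ : UnitAddTorus d → ℝ) (θ : ℝ → UnitAddTorus d → ℝ) : Prop where
  /-- `θ` is a.e. strongly measurable on `(0,T) × T^d` (through the space–time lift). -/
  aestronglyMeasurable : AEStronglyMeasurable (FunctionSpaces.Torus.stLift θ) (volume.restrict (Ioo 0 T ×ˢ univ))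
  /-- `u` is a.e. strongly measurable on `(0,T) × T^d` (through the space–time lift). -/
  aestronglyMeasurable_velocity :
    AEStronglyMeasurable (FunctionSpaces.Torus.stLift u) (volume.restrict (Ioo 0 T ×ˢ univ))
  /-- `θ ∈ L^∞(0,T; L²(T^d))`: `∫ |θ(t)|² ≤ C` for a.e. `t ∈ (0,T)`. -/
  ae_lintegral_sq_le : ∃ C : ℝ≥0, ∀ᵐ t ∂(volume.restrict (Ioo 0 T)), ∫⁻ x, ‖θ t x‖ₑ ^ 2 ≤ C
  /-- `u ∈ L¹(0,T; L²(T^d))`: `∫₀ᵀ (∫ ‖u(t)‖²)^{1/2} dt < ∞`. -/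
  lintegral_velocity_lt_top :
    ∫⁻ t in Ioo 0 T, (∫⁻ x, ‖u t x‖ₑ ^ 2) ^ (1 / 2 : ℝ) < ∞
  /-- `u θ ∈ L¹((0,T) × T^d)`. -/
  lintegral_mul_lt_top : ∫⁻ t in Ioo 0 T, ∫⁻ x, ‖u t x‖ₑ * ‖θ t x‖ₑ < ∞
  /-- `div u(t) = 0` weakly, for a.e. `t ∈ (0,T)`. -/
  ae_isWeaklyDivFree : ∀ᵐ t ∂(volume.restrict (Ioo 0 T)), FunctionSpaces.Torus.IsWeaklyDivFree (u t)
  /-- The weak formulation with datum: `∫₀ᵀ ∫ θ (∂ₜψ + u·∇ψ + κΔψ) + ∫ θ₀ ψ(0) = 0`. -/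
  weak_eq : ∀ ψ : ℝ → UnitAddTorus d → ℝ, FunctionSpaces.Torus.IsSpaceTimeTest T ψ →
    (∫ t in Ioo 0 T, ∫ x, θ t x *
        (FunctionSpaces.Torus.timeDeriv ψ t x + ⟪u t x, FunctionSpaces.Torus.gradient (ψ t) x⟫_ℝ + κ * FunctionSpaces.Torus.laplacian (ψ t) x)) +
      ∫ x, θ₀ x * ψ 0 x = 0

/-- Classical solutions on a time set `S ⊇ [0, T]` are weak solutions on `[0, T)` with datum
`θ 0` (multiply by a test function, integrate by parts in `x` on the torus — no boundary — and in
`t`, picking up `∫ θ(0) ψ(0)`; DiPerna–Lions 1989, §II.1; Evans, §7.1.2, motivation of the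
definition). The bounds `θ ∈ L^∞_t L²_x`, `u ∈ L¹_t L²_x`, `u θ ∈ L¹_{t,x}` follow from
continuity on the compact `[0,T] × T^d`. [cite: DiPernaLions1989, §II.1] -/
def IsClassicalScalarTransportOn.isWeakScalarTransportOn : Prop :=
  ∀ {S : Set ℝ} {κ T : ℝ} {u : ℝ → UnitAddTorus d → EuclideanSpace ℝ d} {θ : ℝ → UnitAddTorus d → ℝ} (h : IsClassicalScalarTransportOn S κ u θ) (hS : Icc 0 T ⊆ S),
    IsWeakScalarTransportOn T κ u (θ 0) θ

omit [DecidableEq d] in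
/-- **DiPerna–Lions uniqueness.** If `κ ≥ 0` and the velocity field lies in
`L¹(0,T; W^{1,∞}(T^d))` — expressed as: `u ∈ L¹_t L²_x` (part of the definition) and `u(t)` is
`L(t)`-Lipschitz for a.e. `t` with `∫₀ᵀ L < ∞` — then two weak solutions in `L^∞_t L²_x` with the
same datum coincide a.e. on `(0,T) × T^d` (DiPerna–Lions 1989, Thm. II.2 and Cor. II.1 for
`κ = 0`, via renormalisation, Thm. II.3; for `κ > 0`: Le Bris–Lions 2008, Prop. 5 / Figalli 2008,
Thm. 4.3 — Fokker–Planck equations with Sobolev drift, of which div-free `W^{1,∞}` drift with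
constant diffusion is a special case). The difference of two solutions has datum `0`, so no
integrability of `θ₀` is needed. [cite: DiPernaLions1989, Thm. II.2 and Cor. II.1 for  κ = 0   via] -/
def IsWeakScalarTransportOn.unique_of_lipschitz : Prop :=
  ∀ {T κ : ℝ} {u : ℝ → UnitAddTorus d → EuclideanSpace ℝ d} {θ₀ : UnitAddTorus d → ℝ} {θ₁ θ₂ : ℝ → UnitAddTorus d → ℝ} (hκ : 0 ≤ κ) (h₁ : IsWeakScalarTransportOn T κ u θ₀ θ₁) (h₂ : IsWeakScalarTransportOn T κ u θ₀ θ₂) {L : ℝ → ℝ≥0} (hL : ∫⁻ t in Ioo 0 T, (L t : ℝ≥0∞) < ∞) (hlip : ∀ᵐ t ∂(volume.restrict (Ioo 0 T)), LipschitzWith (L t) (u t)),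
    ∀ᵐ t ∂(volume.restrict (Ioo 0 T)), θ₁ t =ᵐ[volume] θ₂ t

omit [DecidableEq d] in
/-- **Existence of energy solutions.** For `κ > 0`, an `L²` datum `θ₀` and a bounded measurable
velocity field `u ∈ L^∞((0,T) × T^d)` which is weakly divergence free for a.e. `t`, there is a
weak solution on `[0,T)`, and it may be chosen to satisfy the energy inequality
`2κ ∫₀ᵀ ‖∇θ‖²_{L²} ≤ ‖θ₀‖²_{L²}` (Galerkin / parabolic energy estimate: Evans, §7.1.2, Thms. 2–3;
DiPerna–Lions 1989, Prop. II.1 for the transport part; DEIJ 2022, (1.2)–(1.3)). [cite: DiPernaLions1989, Prop. II.1 for the transport part] -/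
def exists_isWeakScalarTransportOn : Prop :=
  ∀ {T κ : ℝ} (hκ : 0 < κ) {u : ℝ → UnitAddTorus d → EuclideanSpace ℝ d} {θ₀ : UnitAddTorus d → ℝ} (hθ₀ : MemLp θ₀ 2 volume) (hu : MemLp (FunctionSpaces.Torus.stLift u) ∞ (volume.restrict (Ioo 0 T ×ˢ univ))) (hdiv : ∀ᵐ t ∂(volume.restrict (Ioo 0 T)), FunctionSpaces.Torus.IsWeaklyDivFree (u t)),
    ∃ θ : ℝ → UnitAddTorus d → ℝ, IsWeakScalarTransportOn T κ u θ₀ θ ∧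
      2 * eScalarDissipation κ θ 0 T ≤ ∫⁻ x, ‖θ₀ x‖ₑ ^ 2

omit [DecidableEq d] in
/-- **Energy inequality.** For `κ > 0`, an `L²` datum and a bounded velocity field
`u ∈ L^∞((0,T) × T^d)`, *every* weak solution in `L^∞_t L²_x` satisfies
`2κ ∫₀ᵀ ‖∇θ(t)‖²_{L²} dt ≤ ‖θ₀‖²_{L²}` (in fact with equality: for bounded `u` the drift
`div (uθ)` lies in `L²_t H⁻¹_x`, distributional solutions of the heat equation on the torus in
`L^∞_t L²_x` are unique, hence `θ` is the energy solution of Evans, §7.1.2, Thm. 2–4, and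
`θ ∈ L²_t H¹_x`; DEIJ 2022, (1.2)–(1.3); Armstrong–Vicol 2025, (1.3)). Boundedness of `u` is
needed: for rough `u` the inequality is the selection criterion of `exists_isWeakScalarTransportOn`,
not a theorem. [cite: DEIJ2022, (1.2] -/
def IsWeakScalarTransportOn.energy_ineq : Prop :=
  ∀ {T κ : ℝ} (hκ : 0 < κ) {u : ℝ → UnitAddTorus d → EuclideanSpace ℝ d} {θ₀ : UnitAddTorus d → ℝ} {θ : ℝ → UnitAddTorus d → ℝ} (h : IsWeakScalarTransportOn T κ u θ₀ θ) (hθ₀ : MemLp θ₀ 2 volume) (hu : MemLp (FunctionSpaces.Torus.stLift u) ∞ (volume.restrict (Ioo 0 T ×ˢ univ))),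
    2 * eScalarDissipation κ θ 0 T ≤ ∫⁻ x, ‖θ₀ x‖ₑ ^ 2

omit [DecidableEq d] in
/-- Pointwise-in-time form of the energy inequality under the hypotheses of `energy_ineq`:
for a.e. `t ∈ (0,T)`, `‖θ(t)‖²_{L²} + 2κ ∫₀ᵗ ‖∇θ‖² ≤ ‖θ₀‖²_{L²}` (Evans, §7.1.2, Thm. 2;
DEIJ 2022, (1.3)). [cite: DEIJ2022, (1.3] -/
def IsWeakScalarTransportOn.lintegral_sq_add_le : Prop :=
  ∀ {T κ : ℝ} (hκ : 0 < κ) {u : ℝ → UnitAddTorus d → EuclideanSpace ℝ d} {θ₀ : UnitAddTorus d → ℝ} {θ : ℝ → UnitAddTorus d → ℝ} (h : IsWeakScalarTransportOn T κ u θ₀ θ) (hθ₀ : MemLp θ₀ 2 volume) (hu : MemLp (FunctionSpaces.Torus.stLift u) ∞ (volume.restrict (Ioo 0 T ×ˢ univ))),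
    ∀ᵐ t ∂(volume.restrict (Ioo 0 T)),
      (∫⁻ x, ‖θ t x‖ₑ ^ 2) + 2 * eScalarDissipation κ θ 0 t ≤ ∫⁻ x, ‖θ₀ x‖ₑ ^ 2

omit [DecidableEq d] in
/-- **Energy inequality, variance form.** Under the hypotheses of `energy_ineq`,
`2κ ∫₀ᵀ ‖∇θ(t)‖²_{L²} dt ≤ Var θ₀ = ‖θ₀ - ∫ θ₀‖²_{L²}`: the mean is conserved and `θ - ∫ θ₀`
is a weak solution with datum `θ₀ - ∫ θ₀` and the same gradient, so `energy_ineq` applies to it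
(DEIJ 2022, (1.3); Armstrong–Vicol 2025, §1.1, mean-zero data). This is the outline's
`scalarDissipation_le_variance`. [cite: DEIJ2022, (1.3] -/
def IsWeakScalarTransportOn.eScalarDissipation_le_variance : Prop :=
  ∀ {T κ : ℝ} (hκ : 0 < κ) {u : ℝ → UnitAddTorus d → EuclideanSpace ℝ d} {θ₀ : UnitAddTorus d → ℝ} {θ : ℝ → UnitAddTorus d → ℝ} (h : IsWeakScalarTransportOn T κ u θ₀ θ) (hθ₀ : MemLp θ₀ 2 volume) (hu : MemLp (FunctionSpaces.Torus.stLift u) ∞ (volume.restrict (Ioo 0 T ×ˢ univ))),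
    2 * eScalarDissipation κ θ 0 T ≤ ENNReal.ofReal (scalarVariance θ₀)

end Weak

end Torus

end

end Literature.Analysis.FluidPDE
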